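import Mathlib
import HarnessLib
import Summits.HubbardSuperconductivity.HubbardSuperconductivity.Theorems.KLProgrammeKLRegimeSplitFrameExtSymbolBounds
import Summits.HubbardSuperconductivity.HubbardSuperconductivity.Theorems.KLProgrammeKLRegimeSplitBundleV6

/-!
# Route `KLProgramme`, crux K3 — ENGINE child `KLRegimeEngineV11` (stmt-HubbardSuperconductivity-19823), two-leg stubs: the FLAT-CUTOFF
# profile of `klFlatCutoff` (support, flatness, smoothness, EXPLICIT derivative bounds), the flat-cutoff G-extension symbol on
# `klWindowC` (global all-order bounds), and `klFrameExtG = symInterp (symbol at the CENTRED lattice momenta)`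

Cell gate-hubbard-kl, seat hubbard-kl-k3c3-p1 (g2; row «δμ-flow with `klAngularMean` constant piece»).  Sequel of
`…SplitFrameExtSymbolBounds` (abstract radial profile `ψ`): here `ψ = ψ_μ`, the profile of the bundle's flat cutoff
`klFlatCutoff L μ k = 1 − χ₂((ε(k) − μ)²/(4·klFlatR²)) = 1 − χ₂(100(ε(p_k) − μ)²)` (`klFlatR = 1/20`, `χ₂ = salmhoferCutoff`):

* §1 `klFlatCutoff_eq_profile_sqDispersion` (the bundle's cutoff IS `ψ_μ ∘ ε ∘ latticeMomentum`), `flatProfile_eq_zero_of_le`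
  (support `|u − μ| ≤ 1/10`), `flatProfile_eq_one_of_le` (flat on `|u − μ| ≤ 1/20`), `contDiff_flatProfile`, the inner quadratic's
  derivatives (`iteratedDeriv_flatInner`: `200(u−μ), 200, 0, …`; `‖Dˡ‖ ≤ 200ˡ` on the support) and
  **`norm_iteratedFDeriv_flatProfile_le`**: `‖Dⁱψ_μ‖ ≤ 2·n!·X·200ⁿ` (`i ≤ n`) from `‖Dˡχ₂‖ ≤ X` (`l ≤ n`) — the only non-numeral input,
  the derivative sizes of Salmhofer's `χ₂` (k3c2-p2's lane: `|χ₂′| ≤ 32/3`, …);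
* §2 **`norm_iteratedFDeriv_flatSymbol_le`**: for `μ ∈ klWindowC` and a `2π`-periodic angular profile `g` with `‖Dⁱg‖ ≤ G` (`i ≤ n`),
  at EVERY momentum `‖Dⁿ(ψ_μ(ε)·g(θ))(q)‖ ≤ (n!)²·(2·n!·X·200ⁿ)·G·(4 + max 1 (5(n−1)!/8))ⁿ` (the tube radius `8/5`:
  `(8/5)² ≤ μ − 1/10 + 4` on the window) — VOLUME-FREE and SCALE-FREE, LINEAR in the angular size `G`: with `g = ν − mean ν` the scale-`n`
  increment profile, `G ∝ |U|Λ_n²·(Λ_n⁻¹)ⁱ` reproduces the `twoLegBar` law order by order;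
* §3 `sqDispersion_torusCentredMomentum` and **`klFrameExtG_eq_symInterp_symbol`**: `klFrameExtG L μ f = symInterp L (k ↦ S_f(p̄_k))`,
  `S_f(p) = m + ψ_μ(ε(p))·(f(θ(p)) − m)`, `m = klAngularMean f`, `p̄_k = torusCentredMomentum L k` — the G-extension's lattice data
  ARE the samples of the symbol at the centred lattice momenta (the constant piece `m` exact; `θ = polarAngle`).

What remains for the sequel (bookkeeping, no analysis): the centring `p ↦ p̄` is a translation near every point of the tube and
`S_f ∘ (p ↦ p̄)` is the `2π`-periodic `D₄`-symmetric smooth function on `ℝ²` whose samples at ALL `latticeMomentum L k` are the data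
(the form the interpolation theorems of the symInterp toolkit part 5 consume).  Proofs only (no definitions); nothing is asserted about
the model.  References: BGM 2006 [arXiv:cond-mat/0507686] §2.3 (2.28) (Salmhofer's `χ₂`), §2.3–2.4 ((2.36), (2.40)); BundleV6 §1
(`klFlatCutoff`, `klAngularMean`, `klFrameExtG`).
-/

noncomputable section

namespace Summit.HubbardSuperconductivity.HubbardSuperconductivity.Theorems.KLRegimeSplit

set_option linter.dupNamespace false -- summit = problem name (single-conjunct summit), D-0017

open Real Finset Filter Literature.MathematicalPhysics.QuantumLattice Literature.Probability.LatticeModels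
open scoped Topology

/-! ## §1 The flat-cutoff profile `ψ_μ(u) = 1 − χ₂(100(u−μ)²)` -/

/-- `4·klFlatR² = 1/100`: the argument of `χ₂` in `klFlatCutoff` is `100(ε − μ)²`. -/
theorem div_four_klFlatR_sq (x : ℝ) : x / (4 * klFlatR ^ 2) = 100 * x := by
  rw [klFlatR]; ring

/-- **`klFlatCutoff` is the flat-cutoff profile read at the free band**: `χ_flat(k) = 1 − χ₂(100(ε(p_k) − μ)²)`. -/
theorem klFlatCutoff_eq_profile_sqDispersion {L : ℕ} [NeZero L] (μ : ℝ) (k : TorusSite 2 L) :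
    klFlatCutoff L μ k = 1 - salmhoferCutoff (100 * (sqDispersion (latticeMomentum L k) - μ) ^ 2) := by
  have hb : torusBand L k = sqDispersion (latticeMomentum L k) := by
    simp only [torusBand, sqDispersion, Fin.sum_univ_two]
  rw [klFlatCutoff, div_four_klFlatR_sq, nambuXi, hb]

/-- **Support**: the profile vanishes for `|u − μ| ≥ 1/10`. -/
theorem flatProfile_eq_zero_of_le {μ u : ℝ} (h : 1 / 10 ≤ |u - μ|) : 1 - salmhoferCutoff (100 * (u - μ) ^ 2) = 0 := by
  have h1 : (1 : ℝ) ≤ 100 * (u - μ) ^ 2 := by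
    have hsq : (1 / 10 : ℝ) ^ 2 ≤ |u - μ| ^ 2 := pow_le_pow_left₀ (by norm_num) h 2
    rw [sq_abs] at hsq
    nlinarith
  rw [salmhoferCutoff_of_ge h1, sub_self]

/-- **Flatness**: the profile is `1` for `|u − μ| ≤ 1/20`. -/
theorem flatProfile_eq_one_of_le {μ u : ℝ} (h : |u - μ| ≤ 1 / 20) : 1 - salmhoferCutoff (100 * (u - μ) ^ 2) = 1 := by
  have h1 : 100 * (u - μ) ^ 2 ≤ 1 / 4 := by
    have hsq : |u - μ| ^ 2 ≤ (1 / 20 : ℝ) ^ 2 := pow_le_pow_left₀ (abs_nonneg _) h 2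
    rw [sq_abs] at hsq
    nlinarith
  rw [salmhoferCutoff_of_le h1, sub_zero]

/-- The profile is smooth. -/
theorem contDiff_flatProfile (μ : ℝ) {n : ℕ∞} : ContDiff ℝ n fun u : ℝ => 1 - salmhoferCutoff (100 * (u - μ) ^ 2) :=
  contDiff_const.sub (contDiff_salmhoferCutoff.comp (contDiff_const.mul ((contDiff_id.sub contDiff_const).pow 2)))

/-- The inner quadratic `u ↦ 100(u−μ)²`: iterated derivatives `200(u−μ)`, `200`, `0, 0, …`. -/
theorem iteratedDeriv_flatInner (μ : ℝ) :
    (iteratedDeriv 1 (fun u : ℝ => 100 * (u - μ) ^ 2) = fun u => 200 * (u - μ)) ∧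
      (iteratedDeriv 2 (fun u : ℝ => 100 * (u - μ) ^ 2) = fun _ => (200 : ℝ)) ∧
        ∀ l : ℕ, iteratedDeriv (l + 3) (fun u : ℝ => 100 * (u - μ) ^ 2) = fun _ => (0 : ℝ) := by
  have h1 : iteratedDeriv 1 (fun u : ℝ => 100 * (u - μ) ^ 2) = fun u => 200 * (u - μ) := by
    rw [iteratedDeriv_one]
    funext u
    have h : HasDerivAt (fun u : ℝ => 100 * (u - μ) ^ 2) (100 * (2 * (u - μ) ^ 1 * 1)) u :=
      (((hasDerivAt_id u).sub_const μ).pow 2).const_mul 100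
    rw [h.deriv]; ring
  have h2 : iteratedDeriv 2 (fun u : ℝ => 100 * (u - μ) ^ 2) = fun _ => (200 : ℝ) := by
    rw [iteratedDeriv_succ, h1]
    funext u
    have h : HasDerivAt (fun u : ℝ => 200 * (u - μ)) (200 * 1) u := ((hasDerivAt_id u).sub_const μ).const_mul 200
    rw [h.deriv]; ring
  refine ⟨h1, h2, fun l => ?_⟩
  induction l with
  | zero =>
    rw [show (0 + 3 : ℕ) = 2 + 1 from rfl, iteratedDeriv_succ, h2]
    funext u; exact deriv_const u _
  | succ l ih =>
    rw [show l + 1 + 3 = (l + 3) + 1 by omega, iteratedDeriv_succ, ih]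
    funext u; exact deriv_const u _

/-- On the support region `|u − μ| ≤ 1/10` the inner quadratic has `‖Dˡ‖ ≤ 200ˡ` for every `l ≥ 1`. -/
theorem norm_iteratedFDeriv_flatInner_le {μ u : ℝ} (hu : |u - μ| ≤ 1 / 10) {l : ℕ} (hl : 1 ≤ l) :
    ‖iteratedFDeriv ℝ l (fun u : ℝ => 100 * (u - μ) ^ 2) u‖ ≤ (200 : ℝ) ^ l := by
  obtain ⟨h1, h2, h3⟩ := iteratedDeriv_flatInner μ
  rw [norm_iteratedFDeriv_eq_norm_iteratedDeriv, Real.norm_eq_abs]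
  rcases Nat.lt_or_ge l 3 with hlt | hge
  · interval_cases l
    · rw [h1]
      simp only [abs_mul, pow_one]
      rw [abs_of_pos (by norm_num : (0 : ℝ) < 200)]
      nlinarith [abs_nonneg (u - μ)]
    · rw [h2]
      norm_num
  · obtain ⟨l', rfl⟩ : ∃ l', l = l' + 3 := ⟨l - 3, by omega⟩
    rw [h3 l']
    simp only [abs_zero]
    positivity

/-- **Explicit derivative bounds of the flat-cutoff profile**: if `‖Dˡχ₂‖ ≤ X` for `l ≤ n`, then for every `i ≤ n` and every `u`,
`‖Dⁱ (1 − χ₂(100(·−μ)²))(u)‖ ≤ 2·n!·X·200ⁿ`. -/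
theorem norm_iteratedFDeriv_flatProfile_le {μ : ℝ} {n : ℕ} {X : ℝ}
    (hX : ∀ l ≤ n, ∀ x : ℝ, ‖iteratedFDeriv ℝ l salmhoferCutoff x‖ ≤ X) {i : ℕ} (hi : i ≤ n) (u : ℝ) :
    ‖iteratedFDeriv ℝ i (fun u : ℝ => 1 - salmhoferCutoff (100 * (u - μ) ^ 2)) u‖ ≤ 2 * n.factorial * X * 200 ^ n := by
  have hX1 : 1 ≤ X := by
    have h := hX 0 (Nat.zero_le _) 1
    rw [iteratedFDeriv_zero_eq_comp, Function.comp_apply, LinearIsometryEquiv.norm_map, salmhoferCutoff_of_ge le_rfl,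
      norm_one] at h
    exact h
  have hnf : (1 : ℝ) ≤ n.factorial := by exact_mod_cast Nat.one_le_iff_ne_zero.mpr (Nat.factorial_ne_zero n)
  have h200 : (1 : ℝ) ≤ 200 ^ n := one_le_pow₀ (by norm_num)
  -- the composite `χ₂ ∘ (100(·−μ)²)` has `‖Dⁱ‖ ≤ n!·X·200ⁿ` at every point
  have hcomp : ‖iteratedFDeriv ℝ i (fun u : ℝ => salmhoferCutoff (100 * (u - μ) ^ 2)) u‖ ≤ n.factorial * X * 200 ^ n := by
    by_cases hu : |u - μ| ≤ 1 / 10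
    · have hin : ContDiff ℝ ((n : ℕ∞) : WithTop ℕ∞) (fun u : ℝ => 100 * (u - μ) ^ 2) :=
        contDiff_const.mul ((contDiff_id.sub contDiff_const).pow 2)
      have h := norm_iteratedFDeriv_comp_le (g := salmhoferCutoff) (f := fun u : ℝ => 100 * (u - μ) ^ 2)
        (contDiff_salmhoferCutoff (n := n)) hin (by exact_mod_cast hi) u (C := X) (D := 200)
        (fun l hl => hX l (hl.trans hi) _) (fun l hl1 _ => norm_iteratedFDeriv_flatInner_le hu hl1)
      refine h.trans ?_
      have hfi : (i.factorial : ℝ) ≤ n.factorial := by exact_mod_cast Nat.factorial_le hi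
      have hX0 : 0 ≤ X := zero_le_one.trans hX1
      exact mul_le_mul (mul_le_mul_of_nonneg_right hfi hX0) (pow_le_pow_right₀ (by norm_num) hi) (by positivity)
        (by positivity)
    · -- off the support the composite is locally `1`
      have hopen : IsOpen {v : ℝ | 1 / 10 < |v - μ|} := isOpen_lt continuous_const (continuous_id.sub continuous_const).abs
      have hev : (fun u : ℝ => salmhoferCutoff (100 * (u - μ) ^ 2)) =ᶠ[𝓝 u] fun _ => (1 : ℝ) := by
        filter_upwards [hopen.mem_nhds (not_le.mp hu)] with v hv
        have := flatProfile_eq_zero_of_le (le_of_lt hv)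
        linarith
      rw [(hev.iteratedFDeriv ℝ i).eq_of_nhds]
      rcases Nat.eq_zero_or_pos i with rfl | hpos
      · rw [iteratedFDeriv_zero_eq_comp, Function.comp_apply, LinearIsometryEquiv.norm_map, norm_one]
        calc (1 : ℝ) = 1 * 1 * 1 := by ring
          _ ≤ n.factorial * X * 200 ^ n := by gcongr
      · rw [iteratedFDeriv_const_of_ne (by omega), Pi.zero_apply, norm_zero]
        positivity
  -- `1 − (·)`: the constant contributes only at order `0`
  have hsub : iteratedFDeriv ℝ i (fun u : ℝ => 1 - salmhoferCutoff (100 * (u - μ) ^ 2)) u =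
      iteratedFDeriv ℝ i (fun _ : ℝ => (1 : ℝ)) u - iteratedFDeriv ℝ i (fun u : ℝ => salmhoferCutoff (100 * (u - μ) ^ 2)) u := by
    have hc : ContDiffAt ℝ (i : WithTop ℕ∞) (fun _ : ℝ => (1 : ℝ)) u := contDiffAt_const
    have hF : ContDiffAt ℝ (i : WithTop ℕ∞) (fun u : ℝ => salmhoferCutoff (100 * (u - μ) ^ 2)) u :=
      ((contDiff_salmhoferCutoff (n := i)).comp (contDiff_const.mul ((contDiff_id.sub contDiff_const).pow 2))).contDiffAt
    rw [show (fun u : ℝ => 1 - salmhoferCutoff (100 * (u - μ) ^ 2)) =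
        (fun _ : ℝ => (1 : ℝ)) - fun u : ℝ => salmhoferCutoff (100 * (u - μ) ^ 2) from rfl, iteratedFDeriv_sub_apply hc hF]
  rw [hsub]
  refine (norm_sub_le _ _).trans ?_
  have hconst : ‖iteratedFDeriv ℝ i (fun _ : ℝ => (1 : ℝ)) u‖ ≤ 1 := by
    rcases Nat.eq_zero_or_pos i with rfl | hpos
    · rw [iteratedFDeriv_zero_eq_comp, Function.comp_apply, LinearIsometryEquiv.norm_map, norm_one]
    · rw [iteratedFDeriv_const_of_ne (by omega), Pi.zero_apply, norm_zero]; exact zero_le_one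
  calc ‖iteratedFDeriv ℝ i (fun _ : ℝ => (1 : ℝ)) u‖ + ‖iteratedFDeriv ℝ i (fun u : ℝ => salmhoferCutoff (100 * (u - μ) ^ 2)) u‖
      ≤ 1 + n.factorial * X * 200 ^ n := add_le_add hconst hcomp
    _ ≤ n.factorial * X * 200 ^ n + n.factorial * X * 200 ^ n := by
        gcongr
        calc (1 : ℝ) = 1 * 1 * 1 := by ring
          _ ≤ n.factorial * X * 200 ^ n := by gcongr
    _ = 2 * n.factorial * X * 200 ^ n := by ring

/-! ## §2 The flat-cutoff symbol on `klWindowC`: global explicit bounds -/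

/-- **THE FLAT-CUTOFF G-EXTENSION SYMBOL ON THE WINDOW — explicit, volume-free, all-order bounds.**  For `μ ∈ klWindowC`, a
`2π`-periodic angular profile `g` (`‖Dⁱg‖ ≤ G`, `i ≤ n`; e.g. `f − klAngularMean f`) and `X` bounding `‖Dˡχ₂‖` (`l ≤ n`):
`‖Dⁿ (q ↦ (1 − χ₂(100(ε(q)−μ)²))·g(θ(q)))(q)‖ ≤ (n!)²·(2·n!·X·200ⁿ)·G·(4 + max 1 (5(n−1)!/8))ⁿ` at EVERY momentum `q`
(radius `r = 8/5`: `r² = 2.56 ≤ μ − 1/10 + 4` on the window). -/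
theorem norm_iteratedFDeriv_flatSymbol_le {g : ℝ → ℝ} {N : WithTop ℕ∞} (hg : ContDiff ℝ N g) (hper : Function.Periodic g (2 * Real.pi))
    {n : ℕ} (hn : (n : WithTop ℕ∞) ≤ N) {G X μ : ℝ} (hμ : μ ∈ klWindowC) (hG : ∀ i ≤ n, ∀ t : ℝ, ‖iteratedFDeriv ℝ i g t‖ ≤ G)
    (hX : ∀ l ≤ n, ∀ x : ℝ, ‖iteratedFDeriv ℝ l salmhoferCutoff x‖ ≤ X) (q : Momentum) :
    ‖iteratedFDeriv ℝ n (fun q : Momentum =>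
        (1 - salmhoferCutoff (100 * (sqDispersion (WithLp.ofLp q) - μ) ^ 2)) * g (polarAngle (WithLp.ofLp q))) q‖ ≤
      (n.factorial : ℝ) ^ 2 * (2 * n.factorial * X * 200 ^ n) * G * (4 + max 1 (((n - 1).factorial : ℝ) / (8 / 5))) ^ n := by
  have hμ' := hμ
  simp only [klWindowC, Set.mem_Icc] at hμ'
  have hψ : ContDiff ℝ (n : WithTop ℕ∞) (fun u : ℝ => 1 - salmhoferCutoff (100 * (u - μ) ^ 2)) := by
    have h := contDiff_flatProfile μ (n := (n : ℕ∞))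
    exact_mod_cast h
  exact norm_iteratedFDeriv_symbol_le_of_support (N := (n : WithTop ℕ∞)) hψ (hg.of_le hn) hper le_rfl
    (fun i hi u => norm_iteratedFDeriv_flatProfile_le hX hi u) hG (δ := 1 / 10) (fun u hu => flatProfile_eq_zero_of_le hu)
    (by norm_num) (by norm_num; linarith) q

/-! ## §3 The `klFrameExtG` data are the values of the symbol at the CENTRED lattice momenta -/

/-- The free band is `2π`-periodic coordinatewise, so it takes the same value at a lattice momentum and at its centred representative. -/
theorem sqDispersion_torusCentredMomentum {L : ℕ} [NeZero L] (k : TorusSite 2 L) :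
    sqDispersion (torusCentredMomentum L k) = sqDispersion (latticeMomentum L k) := by
  have h : ∀ i, Real.cos (torusCentredMomentum L k i) = Real.cos (latticeMomentum L k i) := by
    intro i
    rw [torusCentredMomentum, toIocMod]
    rw [show latticeMomentum L k i - toIocDiv Real.two_pi_pos (-Real.pi) (latticeMomentum L k i) • (2 * Real.pi) =
        latticeMomentum L k i + ((-toIocDiv Real.two_pi_pos (-Real.pi) (latticeMomentum L k i) : ℤ) : ℝ) * (2 * Real.pi) by
        push_cast; ring]
    exact Real.cos_add_int_mul_two_pi _ _
  simp only [sqDispersion, h]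

/-- **The data of the G-extension are samples of the symbol**: for every angular profile `f` and every lattice momentum,
`mean f + χ_flat(k)·(f(θ(k)) − mean f) = m + ψ_μ(ε(p̄_k))·(f(θ(p̄_k)) − m)` with `m = klAngularMean f`, `p̄_k` the centred momentum,
`ψ_μ(u) = 1 − χ₂(100(u−μ)²)` and `θ = polarAngle` — so `klFrameExtG L μ f = symInterp L (k ↦ S_f(p̄_k))`. -/
theorem klFrameExtG_eq_symInterp_symbol {L : ℕ} [NeZero L] (μ : ℝ) (f : ℝ → ℝ) :
    klFrameExtG L μ f = symInterp L fun k =>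
      klAngularMean f + (1 - salmhoferCutoff (100 * (sqDispersion (torusCentredMomentum L k) - μ) ^ 2)) *
        (f (polarAngle (torusCentredMomentum L k)) - klAngularMean f) := by
  unfold klFrameExtG
  congr 1
  funext k
  rw [klFlatCutoff_eq_profile_sqDispersion, sqDispersion_torusCentredMomentum, momentumAngle]

end Summit.HubbardSuperconductivity.HubbardSuperconductivity.Theorems.KLRegimeSplit

end
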